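import Summits.QuantumFields.YangMills.Theorems.IR.Negative.TypShellCondFalseAllG
import Summits.QuantumFields.YangMills.Theorems.LangevinControlUVFemtoCurvatureTwoPointStubDoublingOfRV

/-!
# Crux `IR` (stmt-QuantumFields-19354) — HAIRPIN STOKES for the layer comb, part 1/3: word algebra and Frobenius bounds
# (sections `Algebra`, `Frobenius`)

Re-homed VERBATIM (statements, proofs, names; namespace `…Cruxes.IR.CruxIdea2g7Hairpin` ↦ `…Cruxes.IR.HairpinStokes`) from the
crux workfile `Cruxes/IR/CruxIdea2HairpinStokes.lean` rev 3 (sha16 9564a081d3085d3d; author `ym-cruxidea-19354-2` GEN 7) per owner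
R114 (2) (landing seat: the `ym-19354-disprove-1` lineage, g9), split by its sections into three ≤ 400-line modules chained by import;
the author's module docstring of record is reproduced in part 1/3 `Theorems/IR/Negative/HairpinStokes/Algebra.lean`.
Negative knowledge for stmt-QuantumFields-19354 (`--supports`; closes no stub); not mixing, not a mass gap, nothing about Clay.

AUTHOR'S MODULE DOCSTRING OF RECORD (rev 3, verbatim):

# Crux `IR` (stmt-QuantumFields-19354) — HAIRPIN STOKES for the layer comb, and the row-floor stub R1d′ PROVED
(companion workfile of `Cruxes/IR/CruxIdea2RowFloorPoly.lean`, seat `ym-cruxidea-19354-2` GEN 7)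

The row-floor workfile `CruxIdea2RowFloorPoly.lean` (rev 13, at the 200 kB workfile cap) reduces its ONE stub R1d
`refAction_le_weighted` — after `topFace_energy_comb_le` — to a bound on the HAIRPIN holonomy
`W_j(x) = stair(x) · σ(x,j) · stair(x + e_j)⁻¹` of the staircase transport `FixedMeshAllG.stair`: for a FLAT `σ` the tree's
`FixedMeshAllG.stair_add_single_of_flatZd` gives `W_j(x) = 1`; here, for an ARBITRARY `σ`, the Frobenius deviation
`‖ρ(W_j(x)) − 1‖` is bounded by the sum of the plaquette deviations `‖ρ(σ_q) − 1‖` over the `≤ combLen R x 2 + combLen R x 3`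
plaquettes of the one or two staircase strips swept when the endpoint moves from `x` to `x + e_j` (quantitative non-abelian
Stokes for thin strips).  Self-contained (imports Theorems modules only); all statements are about tree declarations
(`zline`, `stair`, `combPt2`, `combPt3`, `combLen`, `plaquetteHolonomyZd`), so the row-floor workfile's `hairpin b R σ x j`
is `stair b R σ x * σ (x, j) * (stair b R σ (x + Pi.single j 1))⁻¹` by `rfl`.

* `slideLoop ζ μ ν n y := ζ(y,μ) · zline ζ ν n (y+e_μ) · ζ(y + n e_ν, μ)⁻¹ · (zline ζ ν n y)⁻¹` — the boundary holonomy of the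
  thin `1 × n` strip in the `(μ, ν)` plane based at `y`; `slideLoop_succ` (peel the first plaquette:
  `L(n+1, y) = Hol(y, μ, ν) · ζ(y,ν) L(n, y+e_ν) ζ(y,ν)⁻¹`); `norm_map_slideLoop_sub_one_le` (`‖ρ L − 1‖ ≤ Σ_{k<n} ‖ρ Hol(y + k e_ν, μ, ν) − 1‖`,
  unitary `ρ`);
* `stair_add_single_two_eq` ∕ `stair_add_single_one_eq` — the NON-FLAT versions of the tree's `stair_add_single_two/one`:
  `stair(x + e_2) = Z₁Z₂ · L₃ · Z₃ · σ(x,2)` and `stair(x + e_1) = Z₁ · L₂ · Z₂ · L₃' · Z₃ · σ(x,1)` with explicit slide loops;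
* `norm_map_hairpin_three` (`= 0`), `norm_map_hairpin_two_le`, `norm_map_hairpin_one_le`, the uniform
  `norm_map_hairpin_sub_one_le` (every layer direction `j ≠ 0`), its Cauchy–Schwarz square `norm_map_hairpin_sub_one_sq_le`
  (the form R1d consumes: plaquette energies are `‖ρ(σ_q) − 1‖²/2`), and `combLen_le` (`x l ≤ R ⇒ combLen R x l ≤ 2R`: a hairpin
  sweeps `≤ 4R` layer plaquettes).

STATUS (rev 3, seat `ym-cruxidea-19354-2` GEN 7): `lean check` rc 0, NO `sorry`, no warnings.  **Rev 3 PROVES R1d′ =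
`twistAction_le_weighted`** (§ Assembly): for unitary `ρ` and every `n, k₀` there is `C > 0` with, for every `b ≥ 1`, a fixed
weighted plaquette family `(P, w)`, `w ≥ 0`, `Σ_P w ≤ C b⁵`, such that for EVERY `σ`
`wilsonBoundaryAction ρ (rowRegion b n) (twistΦ b (comb b ((2n+2)b+1) k₀) σ) ≤ Σ_{q ∈ P} w q · (N − plaquetteObs ρ q σ)` — which is
the row-floor file's ONE stub R1d `CruxIdea2g7.refAction_le_weighted` VERBATIM after its own `rw [refConfig_eq_twistΦ]`; i.e. the
polynomial row floor `RowFloorPoly ρ n ε δ (1/7)` is now kernel-complete modulo one import (see IMPORT NOTE).  Ingredients of rev 3: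
copies of the row-floor file's §4m plaquette-case lemmas (`energy_topTwist_of_not_topFace`, `topFace_energy_comb_le`, …), the
hairpin Stokes of rev 1, the counts of rev 2 + `bigBox`/`card_touching_rowRegion_le` (`#plaquettesTouching Λ ≤ 6(b+1)((4n+1)b+1)³`),
the coefficient bookkeeping `coef`/`sum_coef_mul`/`sum_coef_le` (per plaquette: mass `2`, plus `≤ 128 R²` on the top face), and
`C = 24(4n+2)³ + 768(4n+2)³(2n+3)²`.  Rev 2 added the TOP-FACE COUNT
(`box_of_mem_rowRegion`, `topBox`, `card_topBox`, `mem_topBox_of_touching`, `card_touching_height_eq_le`, `card_orientations`):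
the plaquettes touching `Λ = rowRegion b n` with base point at height `b` number `≤ 6·((4n+1)b+1)³`.  (Historical, rev 1:) with the hairpin Stokes the residual content
of the row-floor stub R1d `CruxIdea2g7.refAction_le_weighted` was pure COUNTING + ASSEMBLY — now done in § Assembly: split `plaquettesTouching (rowRegion b n)`
by the top-face predicate `q.2.1.1 = 0 ∧ q.1 0 = b` (`CruxIdea2g7.energy_topTwist_of_not_topFace` ∕ `topFace_energy_comb_le`),
insert `norm_map_hairpin_sub_one_sq_le` (at the layer point `x + e₀`, `InLayer` from `rowRegion` membership, `R = (2n+2)b+1`),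
and count: `#plaquettesTouching Λ ≤ C(n) b⁴` (`CruxIdea2g7.rowRegion_counts`) and the top-face count of rev 2 (`≤ 6((4n+1)b+1)³`),
which with the per-hairpin weight `16 (n₃² + n₂²) ≤ 128 R²` gives total weight `≤ C b⁵`.  IMPORT NOTE: crux workfiles cannot import
each other, and `CruxIdea2RowFloorPoly.lean` is at the size cap — the intended path is that the `Negative/` lane owner re-homes THIS
sorry-free file under `Theorems/IR/Negative/…` (as was done for GEN 6's workfile), after which R1d closes inside the row-floor file
by the four lines `obtain ⟨C, hC, h⟩ := CruxIdea2g7Hairpin.twistAction_le_weighted ρ hρu n k₀; refine ⟨C, hC, fun b hb => ?_⟩;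
obtain ⟨P, w, hw, hs, hd⟩ := h b hb; exact ⟨P, w, hw, hs, fun σ => by rw [refConfig_eq_twistΦ]; exact hd σ⟩`.  Negative-side knowledge for stmt-QuantumFields-19354;
closes no registered stub; count-neutral.
-/

set_option autoImplicit false

noncomputable section

open Literature.MathematicalPhysics.QuantumLattice
open Literature.Probability.LatticeModels
open Summit.QuantumFields.YangMills.Cruxes.IR.FixedMeshAllG
open Summit.QuantumFields.YangMills.Theorems.FemtoCurvatureTwoPoint.DoublingOfRV (norm_rho_mul_sub_one_le norm_rho_inv_sub_one)

namespace Summit.QuantumFields.YangMills.Cruxes.IR.HairpinStokes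

section Algebra

variable {G : Type} [Group G]

/-- The boundary holonomy of the thin `1 × n` strip in the `(μ, ν)` plane based at `y`:
up `μ`, along `ν` for `n` steps, down `μ`, back along `ν`. -/
def slideLoop (ζ : LGConfig 4 G) (μ ν : Fin 4) (n : ℕ) (y : Site 4) : G :=
  ζ (y, μ) * zline ζ ν n (y + Pi.single μ 1) * (ζ (y + Pi.single ν (n : ℤ), μ))⁻¹ * (zline ζ ν n y)⁻¹

/-- Helper lemma `slideLoop_zero` of the hairpin-Stokes chain (re-homed verbatim from the crux workfile; see the module docstring). -/
theorem slideLoop_zero (ζ : LGConfig 4 G) (μ ν : Fin 4) (y : Site 4) : slideLoop ζ μ ν 0 y = 1 := by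
  simp [slideLoop]

/-- Peeling the first plaquette off the strip. -/
theorem slideLoop_succ (ζ : LGConfig 4 G) (μ ν : Fin 4) (n : ℕ) (y : Site 4) :
    slideLoop ζ μ ν (n + 1) y =
      plaquetteHolonomyZd ζ y μ ν * (ζ (y, ν) * slideLoop ζ μ ν n (y + Pi.single ν 1) * (ζ (y, ν))⁻¹) := by
  simp only [slideLoop, plaquetteHolonomyZd, zline_succ]
  rw [show y + Pi.single μ (1 : ℤ) + Pi.single ν 1 = y + Pi.single ν 1 + Pi.single μ 1 from add_right_comm _ _ _,
    show y + Pi.single ν (1 : ℤ) + Pi.single ν (n : ℤ) = y + Pi.single ν ((n + 1 : ℕ) : ℤ) by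
      rw [add_assoc, single_add_nat]]
  group

/-- The SLIDE IDENTITY for an arbitrary configuration (the tree's `mul_zline_eq_of_flatZd` has `slideLoop = 1`). -/
theorem mul_zline_eq_slideLoop (ζ : LGConfig 4 G) (μ ν : Fin 4) (n : ℕ) (y : Site 4) :
    ζ (y, μ) * zline ζ ν n (y + Pi.single μ 1) =
      slideLoop ζ μ ν n y * zline ζ ν n y * ζ (y + Pi.single ν (n : ℤ), μ) := by
  simp only [slideLoop]
  group

/-- Direction 3: pure extension of the last segment — the hairpin is trivial (tree `stair_add_single_three`). -/
theorem hairpin_three (ζ : LGConfig 4 G) {b R : ℕ} {x : Site 4} (hx : InLayer b R x) :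
    stair b R ζ x * ζ (x, 3) * (stair b R ζ (x + Pi.single 3 1))⁻¹ = 1 := by
  rw [stair_add_single_three ζ hx]
  group

/-- Direction 2, NON-FLAT: `stair(x + e_2) = Z₁ Z₂ · L · Z₃ · σ(x, 2)` with the slide loop `L` of the last segment. -/
theorem stair_add_single_two_eq (ζ : LGConfig 4 G) {b R : ℕ} {x : Site 4} (hx : InLayer b R x) :
    stair b R ζ (x + Pi.single 2 1) =
      zline ζ 1 (combLen R x 1) (combRoot b R) * zline ζ 2 (combLen R x 2) (combPt2 b R x) *
        slideLoop ζ 2 3 (combLen R x 3) (combPt3 b R x) * zline ζ 3 (combLen R x 3) (combPt3 b R x) * ζ (x, 2) := by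
  have hx3 := combPt3_add_eq hx
  have e1 : combLen R (x + Pi.single 2 1) 1 = combLen R x 1 := combLen_add_single_of_ne x (by decide)
  have e3 : combLen R (x + Pi.single 2 1) 3 = combLen R x 3 := combLen_add_single_of_ne x (by decide)
  have e2 : combLen R (x + Pi.single 2 1) 2 = combLen R x 2 + 1 := combLen_add_single_self (hx.2 2 (by decide))
  have p2 : combPt2 b R (x + Pi.single 2 1) = combPt2 b R x := by simp only [combPt2, e1]
  have p3 : combPt3 b R (x + Pi.single 2 1) = combPt3 b R x + Pi.single 2 1 := by
    simp only [combPt3, p2, e2, single_natCast_succ, add_assoc]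
  have s3 := mul_zline_eq_slideLoop ζ 2 3 (combLen R x 3) (combPt3 b R x)
  rw [hx3] at s3
  have hp3 : combPt2 b R x + Pi.single 2 (combLen R x 2 : ℤ) = combPt3 b R x := rfl
  unfold stair
  rw [e1, e2, e3, p2, p3, zline_succ_right, hp3]
  calc zline ζ 1 (combLen R x 1) (combRoot b R) * (zline ζ 2 (combLen R x 2) (combPt2 b R x) * ζ (combPt3 b R x, 2)) *
        zline ζ 3 (combLen R x 3) (combPt3 b R x + Pi.single 2 1)
      = zline ζ 1 (combLen R x 1) (combRoot b R) * zline ζ 2 (combLen R x 2) (combPt2 b R x) *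
        (ζ (combPt3 b R x, 2) * zline ζ 3 (combLen R x 3) (combPt3 b R x + Pi.single 2 1)) := by group
    _ = _ := by rw [s3]; group

/-- Direction 1, NON-FLAT: two slide loops (segments 2 and 3). -/
theorem stair_add_single_one_eq (ζ : LGConfig 4 G) {b R : ℕ} {x : Site 4} (hx : InLayer b R x) :
    stair b R ζ (x + Pi.single 1 1) =
      zline ζ 1 (combLen R x 1) (combRoot b R) *
        slideLoop ζ 1 2 (combLen R x 2) (combPt2 b R x) * zline ζ 2 (combLen R x 2) (combPt2 b R x) *
        slideLoop ζ 1 3 (combLen R x 3) (combPt3 b R x) * zline ζ 3 (combLen R x 3) (combPt3 b R x) * ζ (x, 1) := by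
  have hx3 := combPt3_add_eq hx
  have e2 : combLen R (x + Pi.single 1 1) 2 = combLen R x 2 := combLen_add_single_of_ne x (by decide)
  have e3 : combLen R (x + Pi.single 1 1) 3 = combLen R x 3 := combLen_add_single_of_ne x (by decide)
  have e1 : combLen R (x + Pi.single 1 1) 1 = combLen R x 1 + 1 := combLen_add_single_self (hx.2 1 (by decide))
  have p2 : combPt2 b R (x + Pi.single 1 1) = combPt2 b R x + Pi.single 1 1 := by
    simp only [combPt2, e1, single_natCast_succ, add_assoc]
  have p3 : combPt3 b R (x + Pi.single 1 1) = combPt3 b R x + Pi.single 1 1 := by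
    simp only [combPt3, p2, e2]; rw [add_right_comm]
  have s2 := mul_zline_eq_slideLoop ζ 1 2 (combLen R x 2) (combPt2 b R x)
  have s3 := mul_zline_eq_slideLoop ζ 1 3 (combLen R x 3) (combPt3 b R x)
  rw [hx3] at s3
  have hp2 : combRoot b R + Pi.single 1 (combLen R x 1 : ℤ) = combPt2 b R x := rfl
  have hp3 : combPt2 b R x + Pi.single 2 (combLen R x 2 : ℤ) = combPt3 b R x := rfl
  rw [hp3] at s2
  unfold stair
  rw [e1, e2, e3, p2, p3, zline_succ_right, hp2]
  calc zline ζ 1 (combLen R x 1) (combRoot b R) * ζ (combPt2 b R x, 1) *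
        zline ζ 2 (combLen R x 2) (combPt2 b R x + Pi.single 1 1) *
        zline ζ 3 (combLen R x 3) (combPt3 b R x + Pi.single 1 1)
      = zline ζ 1 (combLen R x 1) (combRoot b R) * (ζ (combPt2 b R x, 1) *
        zline ζ 2 (combLen R x 2) (combPt2 b R x + Pi.single 1 1)) *
        zline ζ 3 (combLen R x 3) (combPt3 b R x + Pi.single 1 1) := by group
    _ = zline ζ 1 (combLen R x 1) (combRoot b R) * slideLoop ζ 1 2 (combLen R x 2) (combPt2 b R x) *
        zline ζ 2 (combLen R x 2) (combPt2 b R x) *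
        (ζ (combPt3 b R x, 1) * zline ζ 3 (combLen R x 3) (combPt3 b R x + Pi.single 1 1)) := by
        rw [s2]; group
    _ = _ := by rw [s3]; group

/-- The hairpin in direction 2 is a conjugate of the inverse slide loop. -/
theorem hairpin_two_eq (ζ : LGConfig 4 G) {b R : ℕ} {x : Site 4} (hx : InLayer b R x) :
    stair b R ζ x * ζ (x, 2) * (stair b R ζ (x + Pi.single 2 1))⁻¹ =
      (zline ζ 1 (combLen R x 1) (combRoot b R) * zline ζ 2 (combLen R x 2) (combPt2 b R x)) *
        (slideLoop ζ 2 3 (combLen R x 3) (combPt3 b R x))⁻¹ *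
        (zline ζ 1 (combLen R x 1) (combRoot b R) * zline ζ 2 (combLen R x 2) (combPt2 b R x))⁻¹ := by
  rw [stair_add_single_two_eq ζ hx]
  unfold stair
  group

/-- The hairpin in direction 1 is a product of two conjugated inverse slide loops. -/
theorem hairpin_one_eq (ζ : LGConfig 4 G) {b R : ℕ} {x : Site 4} (hx : InLayer b R x) :
    stair b R ζ x * ζ (x, 1) * (stair b R ζ (x + Pi.single 1 1))⁻¹ =
      ((zline ζ 1 (combLen R x 1) (combRoot b R) * zline ζ 2 (combLen R x 2) (combPt2 b R x)) *
          (slideLoop ζ 1 3 (combLen R x 3) (combPt3 b R x))⁻¹ *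
          (zline ζ 1 (combLen R x 1) (combRoot b R) * zline ζ 2 (combLen R x 2) (combPt2 b R x))⁻¹) *
        (zline ζ 1 (combLen R x 1) (combRoot b R) * (slideLoop ζ 1 2 (combLen R x 2) (combPt2 b R x))⁻¹ *
          (zline ζ 1 (combLen R x 1) (combRoot b R))⁻¹) := by
  rw [stair_add_single_one_eq ζ hx]
  unfold stair
  group

end Algebra

section Frobenius

open scoped Matrix Matrix.Norms.Frobenius

variable {G : Type} [Group G] {N : ℕ} (ρ : G →* Matrix (Fin N) (Fin N) ℂ)

/-- Helper lemma `norm_map_conj_sub_one` of the hairpin-Stokes chain (re-homed verbatim from the crux workfile; see the module docstring). -/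
theorem norm_map_conj_sub_one (hρu : ∀ g, ρ g ∈ Matrix.unitaryGroup (Fin N) ℂ) (k g : G) :
    ‖ρ (k * g * k⁻¹) - 1‖ = ‖ρ g - 1‖ := by
  have h : ρ (k * g * k⁻¹) - 1 = ρ k * (ρ g - 1) * ρ k⁻¹ := by
    rw [map_mul, map_mul, mul_sub, sub_mul, mul_one, mul_assoc (ρ k) (ρ g), ← map_mul, ← map_mul,
      ← map_mul, mul_inv_cancel, map_one]
  rw [h, Matrix.frobenius_norm_mul_unitaryGroup _ ⟨ρ k⁻¹, hρu k⁻¹⟩,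
    Matrix.frobenius_norm_unitaryGroup_mul ⟨ρ k, hρu k⟩]

/-- **QUANTITATIVE STRIP STOKES for the slide loop**: `‖ρ L(μ,ν,n,y) − 1‖ ≤ Σ_{k<n} ‖ρ Hol(y + k e_ν, μ, ν) − 1‖`. -/
theorem norm_map_slideLoop_sub_one_le (hρu : ∀ g, ρ g ∈ Matrix.unitaryGroup (Fin N) ℂ) (ζ : LGConfig 4 G)
    (μ ν : Fin 4) : ∀ (n : ℕ) (y : Site 4),
    ‖ρ (slideLoop ζ μ ν n y) - 1‖ ≤
      ∑ k ∈ Finset.range n, ‖ρ (plaquetteHolonomyZd ζ (y + Pi.single ν (k : ℤ)) μ ν) - 1‖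
  | 0, y => by simp [slideLoop_zero]
  | n + 1, y => by
    rw [slideLoop_succ, Finset.sum_range_succ']
    refine (norm_rho_mul_sub_one_le ρ hρu _ _).trans ?_
    rw [norm_map_conj_sub_one ρ hρu]
    have ih := norm_map_slideLoop_sub_one_le hρu ζ μ ν n (y + Pi.single ν 1)
    have hshift : ∀ k : ℕ, y + Pi.single ν (1 : ℤ) + Pi.single ν (k : ℤ) = y + Pi.single ν ((k + 1 : ℕ) : ℤ) := by
      intro k; rw [add_assoc, single_add_nat]
    simp only [hshift] at ih
    simp only [Nat.cast_zero, Pi.single_zero, add_zero]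
    linarith

/-- Hairpin in direction 3: deviation `0`. -/
theorem norm_map_hairpin_three (ζ : LGConfig 4 G) {b R : ℕ} {x : Site 4} (hx : InLayer b R x) :
    ‖ρ (stair b R ζ x * ζ (x, 3) * (stair b R ζ (x + Pi.single 3 1))⁻¹) - 1‖ = 0 := by
  rw [hairpin_three ζ hx, map_one, sub_self, norm_zero]

/-- **HAIRPIN STOKES, direction 2**: `‖ρ W₂(x) − 1‖ ≤ Σ_{k < combLen R x 3} ‖ρ Hol(combPt3 x + k e₃, 2, 3) − 1‖`. -/
theorem norm_map_hairpin_two_le (hρu : ∀ g, ρ g ∈ Matrix.unitaryGroup (Fin N) ℂ) (ζ : LGConfig 4 G) {b R : ℕ}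
    {x : Site 4} (hx : InLayer b R x) :
    ‖ρ (stair b R ζ x * ζ (x, 2) * (stair b R ζ (x + Pi.single 2 1))⁻¹) - 1‖ ≤
      ∑ k ∈ Finset.range (combLen R x 3),
        ‖ρ (plaquetteHolonomyZd ζ (combPt3 b R x + Pi.single 3 (k : ℤ)) 2 3) - 1‖ := by
  rw [hairpin_two_eq ζ hx, norm_map_conj_sub_one ρ hρu, norm_rho_inv_sub_one ρ hρu]
  exact norm_map_slideLoop_sub_one_le ρ hρu ζ 2 3 _ _

/-- **HAIRPIN STOKES, direction 1**: two strips (`combLen R x 3` plaquettes in the `(1,3)` plane from `combPt3 x`, and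
`combLen R x 2` plaquettes in the `(1,2)` plane from `combPt2 x`). -/
theorem norm_map_hairpin_one_le (hρu : ∀ g, ρ g ∈ Matrix.unitaryGroup (Fin N) ℂ) (ζ : LGConfig 4 G) {b R : ℕ}
    {x : Site 4} (hx : InLayer b R x) :
    ‖ρ (stair b R ζ x * ζ (x, 1) * (stair b R ζ (x + Pi.single 1 1))⁻¹) - 1‖ ≤
      ∑ k ∈ Finset.range (combLen R x 3),
          ‖ρ (plaquetteHolonomyZd ζ (combPt3 b R x + Pi.single 3 (k : ℤ)) 1 3) - 1‖ +
        ∑ k ∈ Finset.range (combLen R x 2),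
          ‖ρ (plaquetteHolonomyZd ζ (combPt2 b R x + Pi.single 2 (k : ℤ)) 1 2) - 1‖ := by
  rw [hairpin_one_eq ζ hx]
  refine (norm_rho_mul_sub_one_le ρ hρu _ _).trans ?_
  rw [norm_map_conj_sub_one ρ hρu, norm_rho_inv_sub_one ρ hρu, norm_map_conj_sub_one ρ hρu,
    norm_rho_inv_sub_one ρ hρu]
  exact add_le_add (norm_map_slideLoop_sub_one_le ρ hρu ζ 1 3 _ _) (norm_map_slideLoop_sub_one_le ρ hρu ζ 1 2 _ _)


/-- **HAIRPIN STOKES, uniform in the layer direction `j ≠ 0`** (for `j = 2` the second sum over-estimates, for `j = 3` the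
hairpin is trivial): `‖ρ W_j(x) − 1‖ ≤ Σ_{k<n₃} ‖ρ Hol(p₃ + k e₃, j, 3) − 1‖ + Σ_{k<n₂} ‖ρ Hol(p₂ + k e₂, 1, 2) − 1‖`,
`n_l = combLen R x l`, `p₂ = combPt2 b R x`, `p₃ = combPt3 b R x` — at most `n₃ + n₂` plaquettes, all in the site layer. -/
theorem norm_map_hairpin_sub_one_le (hρu : ∀ g, ρ g ∈ Matrix.unitaryGroup (Fin N) ℂ) (ζ : LGConfig 4 G) {b R : ℕ}
    {x : Site 4} (hx : InLayer b R x) {j : Fin 4} (hj : j ≠ 0) :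
    ‖ρ (stair b R ζ x * ζ (x, j) * (stair b R ζ (x + Pi.single j 1))⁻¹) - 1‖ ≤
      ∑ k ∈ Finset.range (combLen R x 3),
          ‖ρ (plaquetteHolonomyZd ζ (combPt3 b R x + Pi.single 3 (k : ℤ)) j 3) - 1‖ +
        ∑ k ∈ Finset.range (combLen R x 2),
          ‖ρ (plaquetteHolonomyZd ζ (combPt2 b R x + Pi.single 2 (k : ℤ)) 1 2) - 1‖ := by
  have hA : 0 ≤ ∑ k ∈ Finset.range (combLen R x 3),
      ‖ρ (plaquetteHolonomyZd ζ (combPt3 b R x + Pi.single 3 (k : ℤ)) j 3) - 1‖ :=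
    Finset.sum_nonneg fun _ _ => norm_nonneg _
  have hB : 0 ≤ ∑ k ∈ Finset.range (combLen R x 2),
      ‖ρ (plaquetteHolonomyZd ζ (combPt2 b R x + Pi.single 2 (k : ℤ)) 1 2) - 1‖ :=
    Finset.sum_nonneg fun _ _ => norm_nonneg _
  have h123 : j = 1 ∨ j = 2 ∨ j = 3 := by
    fin_cases j
    · exact absurd rfl hj
    · exact Or.inl rfl
    · exact Or.inr (Or.inl rfl)
    · exact Or.inr (Or.inr rfl)
  rcases h123 with rfl | rfl | rfl
  · exact norm_map_hairpin_one_le ρ hρu ζ hx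
  · exact (norm_map_hairpin_two_le ρ hρu ζ hx).trans (le_add_of_nonneg_right hB)
  · rw [norm_map_hairpin_three ρ ζ hx]; exact add_nonneg hA hB

/-- **HAIRPIN STOKES, squared (Cauchy–Schwarz)** — the form the row-floor stub R1d consumes (plaquette ENERGIES are
`‖ρ(σ_q) − 1‖²/2`): `‖ρ W_j(x) − 1‖² ≤ 2·(n₃ Σ_{k<n₃} ‖ρ Hol(p₃ + k e₃, j, 3) − 1‖² + n₂ Σ_{k<n₂} ‖ρ Hol(p₂ + k e₂, 1, 2) − 1‖²)`. -/
theorem norm_map_hairpin_sub_one_sq_le (hρu : ∀ g, ρ g ∈ Matrix.unitaryGroup (Fin N) ℂ) (ζ : LGConfig 4 G) {b R : ℕ}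
    {x : Site 4} (hx : InLayer b R x) {j : Fin 4} (hj : j ≠ 0) :
    ‖ρ (stair b R ζ x * ζ (x, j) * (stair b R ζ (x + Pi.single j 1))⁻¹) - 1‖ ^ 2 ≤
      2 * ((combLen R x 3 : ℝ) * ∑ k ∈ Finset.range (combLen R x 3),
          ‖ρ (plaquetteHolonomyZd ζ (combPt3 b R x + Pi.single 3 (k : ℤ)) j 3) - 1‖ ^ 2 +
        (combLen R x 2 : ℝ) * ∑ k ∈ Finset.range (combLen R x 2),
          ‖ρ (plaquetteHolonomyZd ζ (combPt2 b R x + Pi.single 2 (k : ℤ)) 1 2) - 1‖ ^ 2) := by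
  have h := norm_map_hairpin_sub_one_le ρ hρu ζ hx hj
  have hA := sq_sum_le_card_mul_sum_sq (s := Finset.range (combLen R x 3))
    (f := fun k : ℕ => ‖ρ (plaquetteHolonomyZd ζ (combPt3 b R x + Pi.single 3 (k : ℤ)) j 3) - 1‖)
  have hB := sq_sum_le_card_mul_sum_sq (s := Finset.range (combLen R x 2))
    (f := fun k : ℕ => ‖ρ (plaquetteHolonomyZd ζ (combPt2 b R x + Pi.single 2 (k : ℤ)) 1 2) - 1‖)
  rw [Finset.card_range] at hA hB
  have h0 : 0 ≤ ‖ρ (stair b R ζ x * ζ (x, j) * (stair b R ζ (x + Pi.single j 1))⁻¹) - 1‖ := norm_nonneg _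
  have h1 := pow_le_pow_left₀ h0 h 2
  nlinarith [h1, hA, hB,
    sq_nonneg (∑ k ∈ Finset.range (combLen R x 3),
        ‖ρ (plaquetteHolonomyZd ζ (combPt3 b R x + Pi.single 3 (k : ℤ)) j 3) - 1‖ -
      ∑ k ∈ Finset.range (combLen R x 2),
        ‖ρ (plaquetteHolonomyZd ζ (combPt2 b R x + Pi.single 2 (k : ℤ)) 1 2) - 1‖)]

end Frobenius

end Summit.QuantumFields.YangMills.Cruxes.IR.HairpinStokes

end
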